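import Literature.Analysis.FluidPDE.KNSSRegularityGalileanProofs
import HarnessLib

/-!
# KNSS 2009, Prop. 4.1 / (4.6) for restarted-mild fields — levels ½ and 1 of the a priori bootstrap

Koch–Nadirashvili–Seregin–Šverák, *Liouville theorems for the Navier–Stokes equations and
applications*, Acta Math. **203** (2009) 83–105 = arXiv:0709.3599v1, §4: Proposition 4.1 asserts
that the mild solution of the Cauchy problem with bounded datum `u₀` is smooth on a short window
`T' = ε‖u₀‖_∞^{-2}` with the scale-invariant bounds (4.6)
`‖t^{k/2}∇ᵏu‖_{L^∞} ≤ C(k)‖u₀‖_∞`. The tree vendors this (for the restarted-mild fields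
`IsKNSSDriftMild T N V 0` of `KNSSRegularityDecomposition.lean`) as the named fact
`KNSS2009_prop41_mild` (`KNSSMildRegularity.lean`), the last undischarged input of the §4 regularity
theorem for bounded ancient weak solutions (`KNSSMildVorticityProofs.lean`:
`KNSS2009_regularity_boundedWeak_ancient_of_prop41'` with `KNSS2009_weak_driftMild_holds`).

This file PROVES the first two levels of an *a priori* bootstrap towards that fact, directly on
the given restarted-mild field (no fixed point, no uniqueness), in the tree's `oseenHeat`
vocabulary (`𝒩_τ F = e^{τΔ}P∇·F`):

* **Level ½** `IsKNSSDriftMild.norm_slice_sub_le_holder`: Hölder continuity of the slices,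
  `‖V(t,x) − V(t,y)‖ ≤ (c₁(β) N (t−s)^{-β/2} + c₂(β) N² (t−s)^{(1−β)/2}) ‖x − y‖^β` (`0 ≤ β < 1`,
  `0 < s < t < T`), by interpolating the maximum principle with the gradient bound of the heat
  flow, and the `L^∞` bound `2943 τ^{-1/2}` of `𝒩_τ` with its gradient bound.
* **Level 1** `IsKNSSDriftMild.hasFDerivAt_slice`, `IsKNSSDriftMild.norm_fderiv_slice_le`,
  `IsKNSSDriftMild.exists_gradient_bound`: the slices are differentiable, with the derivative of
  the mild formula `D V(t) = D e^{(t−s)Δ}V(s) − ∫ₛᵗ D𝒩_{t−σ}[V ⊗ V](σ) dσ`, and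
  `‖DV(t)‖ ≤ κN(t−s)^{-1/2} + P_β N² + Q_β N³(t−s)^{1/2}`; in the window `N²(t − s) ≤ 1` this is
  (4.6) with `k = 1`, `l = 0`: `(t − s)^{1/2}‖DV(t)‖ ≤ C N`.

Tools of independent use: the Hölder modulus of `𝒩_τF` on Hölder data
(`norm_oseenHeat_sub_oseenHeat_le_of_holder`, translation covariance), the gradient of `𝒩_τF` on
Hölder data (`norm_fderiv_oseenHeat_le_holder`: `≤ 2κ(1+2κ)2943·A·τ^{β/2−1}`, integrable at
`τ → 0`), on bounded data (`norm_fderiv_oseenHeat_le_of_top`), interpolated moduli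
(`norm_heatExtension_sub_le_holder`, `norm_oseenHeat_sub_le_holder`), the weight integrals
`∫ₛᵗ (t−σ)^{-a}(σ−s)^{-b} dσ` by the midpoint split (`integral_rpow_neg_mul_rpow_neg_le`),
measurability in `σ` of `D(𝒩_{t−σ}G(σ))` (`aestronglyMeasurable_fderiv_oseenHeat_sub`) and
dominated differentiation of the Duhamel integral on Hölder forcing
(`hasFDerivAt_integral_sum_oseenHeat_duhamel`).

## References

* [KochNadirashviliSereginSverak2009] H. Koch, N. Nadirashvili, G. Seregin, V. Šverák, Acta Math.
  203 (2009) 83–105, doi:10.1007/s11511-009-0039-6, arXiv:0709.3599 — §4 Prop. 4.1, (4.6) (p. 8).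
* Y. Giga, K. Inui, S. Matsui, *On the Cauchy problem for the Navier–Stokes equations with
  nondecaying initial data*, Quad. Mat. 4 (1999) 27–68 — §3 (the weighted smoothing estimates; the
  source KNSS cite for Prop. 4.1).
-/

noncomputable section

open MeasureTheory Set Function Filter TopologicalSpace InnerProductSpace Metric
open _root_.Topology
open scoped RealInnerProductSpace Laplacian ContDiff NNReal ENNReal Interval

namespace Literature.Analysis.FluidPDE

/-! ### Hölder continuity of `𝒩_τ F` and the gradient of `𝒩_τ F` on Hölder data -/

section OseenHolder

variable {E : Type*} [NormedAddCommGroup E] [InnerProductSpace ℝ E] [FiniteDimensional ℝ E]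
  [MeasurableSpace E] [BorelSpace E]

variable {F : Fin (Module.finrank ℝ E) → Fin (Module.finrank ℝ E) → E → ℝ}

/-- Translates of a bounded measurable matrix field are bounded measurable. [folklore] -/
theorem memLp_top_comp_add_right {φ : E → ℝ} (hφ : MemLp φ ∞ volume) (h : E) :
    MemLp (fun y => φ (y + h)) ∞ volume :=
  hφ.comp_measurePreserving (measurePreserving_add_right volume h)

variable (hE : Module.finrank ℝ E = 3)
include hE

/-- **`𝒩_τ` preserves Hölder continuity up to the factor `2943 τ^{-1/2}`**: if
`|Fⱼₖ(y) − Fⱼₖ(z)| ≤ A‖y − z‖^β` for all components then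
`|(𝒩_τF)ᵢ(y) − (𝒩_τF)ᵢ(z)| ≤ 2943 τ^{-1/2} A ‖y − z‖^β` (translation covariance
`𝒩_τ[F(· + h)] = (𝒩_τF)(· + h)`, linearity, and the `L^∞` bound applied to `F(· + h) − F`). [folklore] -/
theorem norm_oseenHeat_sub_oseenHeat_le_of_holder (hF : ∀ j k, MemLp (F j k) ∞ volume) {A β : ℝ}
    (hA : 0 ≤ A) (hH : ∀ j k y z, |F j k y - F j k z| ≤ A * ‖y - z‖ ^ β) {τ : ℝ} (hτ : 0 < τ)
    (i : Fin (Module.finrank ℝ E)) (y z : E) :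
    ‖oseenHeat τ F i y - oseenHeat τ F i z‖ ≤ 2943 * τ ^ (-(1 / 2 : ℝ)) * (A * ‖y - z‖ ^ β) := by
  -- `y = z + h`
  set h : E := y - z with hh
  have hy : y = z + h := by rw [hh]; abel
  rw [hy, ← oseenHeat_comp_add_right F h τ i z]
  refine norm_oseenHeat_sub_oseenHeat_le_of_abs_sub_le hE hF
    (fun j k => memLp_top_comp_add_right (hF j k) h) (by positivity) (fun j k w => ?_) hτ i z
  have := hH j k (w + h) w
  rwa [add_sub_cancel_left] at this

/-- **The gradient of `𝒩_τ F` on Hölder data**: if the components of `F` are bounded by `B` and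
`β`-Hölder with constant `A`, then `‖D(𝒩_τ F)ᵢ(x)‖ ≤ C(n) A τ^{β/2 − 1}` with
`C(n) = 2^{n/2} (τ/2)^{-1/2} (1 + 2·2^{n/2}) (2·τ/2)^{β/2} · 2943 (τ/2)^{-1/2}` (written out):
`𝒩_τ = e^{(τ/2)Δ}𝒩_{τ/2}`, the Hölder gradient bound of the heat flow, and the Hölder constant
`2943 (τ/2)^{-1/2} A` of `𝒩_{τ/2}F`. [folklore] -/
theorem norm_fderiv_oseenHeat_le_of_holder (hF : ∀ j k, MemLp (F j k) ∞ volume) {B : ℝ}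
    (hB0 : 0 ≤ B) (hB : ∀ j k, eLpNorm (F j k) ∞ volume ≤ ENNReal.ofReal B) {A β : ℝ} (hA : 0 ≤ A)
    (hβ0 : 0 ≤ β) (hβ1 : β ≤ 1) (hH : ∀ j k y z, |F j k y - F j k z| ≤ A * ‖y - z‖ ^ β)
    {τ : ℝ} (hτ : 0 < τ) (i : Fin (Module.finrank ℝ E)) (x : E) :
    ‖fderiv ℝ (oseenHeat τ F i) x‖ ≤
      (2 : ℝ) ^ ((Module.finrank ℝ E : ℝ) / 2) * (τ / 2) ^ (-(1 / 2 : ℝ)) *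
        ((1 + 2 * (2 : ℝ) ^ ((Module.finrank ℝ E : ℝ) / 2)) * (2 * (τ / 2)) ^ (β / 2)) *
        (2943 * (τ / 2) ^ (-(1 / 2 : ℝ)) * A) := by
  have h2 : 0 < τ / 2 := half_pos hτ
  -- `𝒩_τ F = e^{(τ/2)Δ} 𝒩_{τ/2} F`
  have hsemi : oseenHeat τ F i = UnboundedOperators.heatExtension (oseenHeat (τ / 2) F i) (τ / 2) := by
    have := oseenHeat_eq_heatExtension hE hF h2 (show τ / 2 < τ by linarith) i
    rw [this]; congr 1; ring
  rw [hsemi]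
  set g : E → ℝ := oseenHeat (τ / 2) F i with hg
  have hgc : Continuous g := (contDiff_oseenHeat hE hF h2 i (n := 0)).continuous
  have hgb : ∀ w, ‖g w‖ ≤ 2943 * (τ / 2) ^ (-(1 / 2 : ℝ)) * B := fun w =>
    norm_oseenHeat_le_of_top hE hF hB0 hB h2 i w
  have hgH : ∀ y z, ‖g y - g z‖ ≤ (2943 * (τ / 2) ^ (-(1 / 2 : ℝ)) * A) * ‖y - z‖ ^ β := by
    intro y z
    have := norm_oseenHeat_sub_oseenHeat_le_of_holder hE hF hA hH h2 i y z
    simpa [hg, mul_assoc] using this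
  exact UnboundedOperators.norm_fderiv_heatExtension_le_of_holder hgc hgb (by positivity) hβ0 hβ1
    hgH h2 x

end OseenHolder

/-! ### The weight integrals `∫ₛᵗ (t − σ)^{-a} (σ − s)^{-b} dσ` by the midpoint split -/

section Weights

/-- Half of the weight integral: `∫ₛᵐ (t − σ)^{-a}(σ − s)^{-b} dσ ≤ (t − m)^{-a} (m − s)^{1−b}/(1 − b)`
for `s ≤ m < t`, `0 ≤ a`, `0 ≤ b < 1`. [folklore] -/
theorem integral_rpow_neg_mul_rpow_neg_left_le {a b s m t : ℝ} (ha0 : 0 ≤ a)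
    (hb1 : b < 1) (hsm : s ≤ m) (hmt : m < t) :
    ∫ σ in s..m, (t - σ) ^ (-a) * (σ - s) ^ (-b) ≤ (t - m) ^ (-a) * ((m - s) ^ (1 - b) / (1 - b)) := by
  have hi1 : IntervalIntegrable (fun σ => (σ - s) ^ (-b)) volume s m := by
    have := (intervalIntegral.intervalIntegrable_rpow' (a := 0) (b := m - s)
      (by linarith : (-1 : ℝ) < -b)).comp_sub_right s
    simpa using this
  have hc : ContinuousOn (fun σ => (t - σ) ^ (-a)) (uIcc s m) := by
    rw [uIcc_of_le hsm]
    exact (continuousOn_const.sub continuousOn_id).rpow_const fun σ hσ =>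
      Or.inl (by linarith [hσ.2] : t - σ ≠ 0)
  have hprod : IntervalIntegrable (fun σ => (t - σ) ^ (-a) * (σ - s) ^ (-b)) volume s m :=
    hi1.continuousOn_mul hc
  have hdom : IntervalIntegrable (fun σ => (t - m) ^ (-a) * (σ - s) ^ (-b)) volume s m :=
    hi1.const_mul _
  calc ∫ σ in s..m, (t - σ) ^ (-a) * (σ - s) ^ (-b)
      ≤ ∫ σ in s..m, (t - m) ^ (-a) * (σ - s) ^ (-b) := by
        refine intervalIntegral.integral_mono_on hsm hprod hdom fun σ hσ => ?_
        refine mul_le_mul_of_nonneg_right ?_ (Real.rpow_nonneg (sub_nonneg.2 hσ.1) _)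
        exact Real.rpow_le_rpow_of_nonpos (by linarith) (by linarith [hσ.2]) (by linarith)
    _ = (t - m) ^ (-a) * ((m - s) ^ (1 - b) / (1 - b)) := by
        rw [intervalIntegral.integral_const_mul, intervalIntegral.integral_comp_sub_right
          (fun u => u ^ (-b)) s, sub_self, integral_rpow (Or.inl (by linarith : (-1 : ℝ) < -b))]
        rw [Real.zero_rpow (by linarith : (-b + 1 : ℝ) ≠ 0), sub_zero,
          show (-b + 1 : ℝ) = 1 - b by ring]

/-- The other half: `∫ₘᵗ (t − σ)^{-a}(σ − s)^{-b} dσ ≤ (m − s)^{-b} (t − m)^{1−a}/(1 − a)` for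
`s < m ≤ t`, `0 ≤ a < 1`, `0 ≤ b`. [folklore] -/
theorem integral_rpow_neg_mul_rpow_neg_right_le {a b s m t : ℝ} (ha1 : a < 1)
    (hb0 : 0 ≤ b) (hsm : s < m) (hmt : m ≤ t) :
    ∫ σ in m..t, (t - σ) ^ (-a) * (σ - s) ^ (-b) ≤ (m - s) ^ (-b) * ((t - m) ^ (1 - a) / (1 - a)) := by
  have hi2 : IntervalIntegrable (fun σ => (t - σ) ^ (-a)) volume m t := by
    have := (intervalIntegral.intervalIntegrable_rpow' (a := t - m) (b := 0)
      (by linarith : (-1 : ℝ) < -a)).comp_sub_left t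
    simpa using this
  have hc : ContinuousOn (fun σ => (σ - s) ^ (-b)) (uIcc m t) := by
    rw [uIcc_of_le hmt]
    exact (continuousOn_id.sub continuousOn_const).rpow_const fun σ hσ =>
      Or.inl (by linarith [hσ.1] : σ - s ≠ 0)
  have hprod : IntervalIntegrable (fun σ => (t - σ) ^ (-a) * (σ - s) ^ (-b)) volume m t :=
    hi2.mul_continuousOn hc
  have hdom : IntervalIntegrable (fun σ => (t - σ) ^ (-a) * (m - s) ^ (-b)) volume m t :=
    hi2.mul_const _
  calc ∫ σ in m..t, (t - σ) ^ (-a) * (σ - s) ^ (-b)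
      ≤ ∫ σ in m..t, (t - σ) ^ (-a) * (m - s) ^ (-b) := by
        refine intervalIntegral.integral_mono_on hmt hprod hdom fun σ hσ => ?_
        refine mul_le_mul_of_nonneg_left ?_ (Real.rpow_nonneg (sub_nonneg.2 hσ.2) _)
        exact Real.rpow_le_rpow_of_nonpos (by linarith) (by linarith [hσ.1]) (by linarith)
    _ = (m - s) ^ (-b) * ((t - m) ^ (1 - a) / (1 - a)) := by
        rw [intervalIntegral.integral_mul_const, intervalIntegral.integral_comp_sub_left
          (fun u => u ^ (-a)) t, sub_self, integral_rpow (Or.inl (by linarith : (-1 : ℝ) < -a))]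
        rw [Real.zero_rpow (by linarith : (-a + 1 : ℝ) ≠ 0), show (-a + 1 : ℝ) = 1 - a by ring]
        ring

/-- **The weight integral by the midpoint split**:
`∫ₛᵗ (t − σ)^{-a}(σ − s)^{-b} dσ ≤ (2^{a+b−1}/(1 − b) + 2^{a+b−1}/(1 − a)) (t − s)^{1−a−b}`
for `0 ≤ a, b < 1`, `s < t`. [folklore] -/
theorem integral_rpow_neg_mul_rpow_neg_le {a b s t : ℝ} (ha0 : 0 ≤ a) (ha1 : a < 1) (hb0 : 0 ≤ b)
    (hb1 : b < 1) (hst : s < t) :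
    ∫ σ in s..t, (t - σ) ^ (-a) * (σ - s) ^ (-b) ≤
      ((2 : ℝ) ^ (a + b - 1) / (1 - b) + (2 : ℝ) ^ (a + b - 1) / (1 - a)) * (t - s) ^ (1 - a - b) := by
  set m : ℝ := (s + t) / 2 with hm
  have hsm : s < m := by rw [hm]; linarith
  have hmt : m < t := by rw [hm]; linarith
  have hd : 0 < t - s := sub_pos.2 hst
  have hms : m - s = (t - s) / 2 := by rw [hm]; ring
  have htm : t - m = (t - s) / 2 := by rw [hm]; ring
  -- integrability on both halves
  have hleft : IntervalIntegrable (fun σ => (t - σ) ^ (-a) * (σ - s) ^ (-b)) volume s m := by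
    have hi1 : IntervalIntegrable (fun σ => (σ - s) ^ (-b)) volume s m := by
      have := (intervalIntegral.intervalIntegrable_rpow' (a := 0) (b := m - s)
        (by linarith : (-1 : ℝ) < -b)).comp_sub_right s
      simpa using this
    refine hi1.continuousOn_mul ?_
    rw [uIcc_of_le hsm.le]
    exact (continuousOn_const.sub continuousOn_id).rpow_const fun σ hσ =>
      Or.inl (by linarith [hσ.2] : t - σ ≠ 0)
  have hright : IntervalIntegrable (fun σ => (t - σ) ^ (-a) * (σ - s) ^ (-b)) volume m t := by
    have hi2 : IntervalIntegrable (fun σ => (t - σ) ^ (-a)) volume m t := by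
      have := (intervalIntegral.intervalIntegrable_rpow' (a := t - m) (b := 0)
        (by linarith : (-1 : ℝ) < -a)).comp_sub_left t
      simpa using this
    refine hi2.mul_continuousOn ?_
    rw [uIcc_of_le hmt.le]
    exact (continuousOn_id.sub continuousOn_const).rpow_const fun σ hσ =>
      Or.inl (by linarith [hσ.1] : σ - s ≠ 0)
  rw [← intervalIntegral.integral_add_adjacent_intervals hleft hright]
  have h1 := integral_rpow_neg_mul_rpow_neg_left_le (a := a) (b := b) (s := s) (m := m) (t := t)
    ha0 hb1 hsm.le hmt
  have h2 := integral_rpow_neg_mul_rpow_neg_right_le (a := a) (b := b) (s := s) (m := m) (t := t)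
    ha1 hb0 hsm hmt.le
  rw [htm, hms] at h1 h2
  -- evaluate the half-weights
  have hhalf : 0 < (t - s) / 2 := by positivity
  have e1 : ((t - s) / 2) ^ (-a) * (((t - s) / 2) ^ (1 - b) / (1 - b)) =
      (2 : ℝ) ^ (a + b - 1) / (1 - b) * (t - s) ^ (1 - a - b) := by
    rw [← mul_div_assoc, ← Real.rpow_add hhalf, Real.div_rpow hd.le zero_le_two,
      show -a + (1 - b) = 1 - a - b by ring]
    have h2pow : (2 : ℝ) ^ (1 - a - b) = ((2 : ℝ) ^ (a + b - 1))⁻¹ := by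
      rw [← Real.rpow_neg zero_le_two, show -(a + b - 1) = 1 - a - b by ring]
    rw [h2pow]
    field_simp
  have e2 : ((t - s) / 2) ^ (-b) * (((t - s) / 2) ^ (1 - a) / (1 - a)) =
      (2 : ℝ) ^ (a + b - 1) / (1 - a) * (t - s) ^ (1 - a - b) := by
    rw [← mul_div_assoc, ← Real.rpow_add hhalf, Real.div_rpow hd.le zero_le_two,
      show -b + (1 - a) = 1 - a - b by ring]
    have h2pow : (2 : ℝ) ^ (1 - a - b) = ((2 : ℝ) ^ (a + b - 1))⁻¹ := by
      rw [← Real.rpow_neg zero_le_two, show -(a + b - 1) = 1 - a - b by ring]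
    rw [h2pow]
    field_simp
  rw [e1] at h1
  rw [e2] at h2
  calc _ ≤ _ := add_le_add h1 h2
    _ = _ := by ring

end Weights

/-! ### Interpolated (Hölder) moduli of the heat flow and of `𝒩_τ` on bounded data -/

section HolderModuli

variable {E : Type*} [NormedAddCommGroup E] [InnerProductSpace ℝ E] [FiniteDimensional ℝ E]
  [MeasurableSpace E] [BorelSpace E]

/-- Interpolation of two bounds: `X ≤ P`, `X ≤ Q`, `0 ≤ X, P, Q` ⇒ `X ≤ P^{1−β} Q^β` for
`0 ≤ β ≤ 1`. [folklore] -/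
theorem le_rpow_mul_rpow_of_le_of_le {X P Q β : ℝ} (hX : 0 ≤ X) (hP : X ≤ P) (hQ : X ≤ Q)
    (hβ0 : 0 ≤ β) (hβ1 : β ≤ 1) : X ≤ P ^ (1 - β) * Q ^ β := by
  have hP0 : 0 ≤ P := hX.trans hP
  have hQ0 : 0 ≤ Q := hX.trans hQ
  calc X = X ^ (1 - β) * X ^ β := by
        rw [← Real.rpow_add' hX (by linarith : (1 - β) + β ≠ 0), show (1 - β) + β = 1 by ring,
          Real.rpow_one]
    _ ≤ P ^ (1 - β) * Q ^ β :=
        mul_le_mul (Real.rpow_le_rpow hX hP (by linarith)) (Real.rpow_le_rpow hX hQ hβ0)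
          (Real.rpow_nonneg hX _) (Real.rpow_nonneg hP0 _)

variable {F' : Type*} [NormedAddCommGroup F'] [NormedSpace ℝ F'] [CompleteSpace F']

/-- **Hölder modulus of the heat flow of bounded measurable data**:
`‖e^{τΔ}f(x) − e^{τΔ}f(y)‖ ≤ (2C)^{1−β} (2^{n/2} τ^{-1/2} C)^β ‖x − y‖^β` for `‖f‖ ≤ C`
(interpolate the maximum principle and the gradient bound). [folklore] -/
theorem norm_heatExtension_sub_le_of_bound_holder {f : E → F'} (hfm : AEStronglyMeasurable f volume)
    {C : ℝ} (hC : ∀ z, ‖f z‖ ≤ C) {β : ℝ} (hβ0 : 0 ≤ β) (hβ1 : β ≤ 1) {τ : ℝ} (hτ : 0 < τ)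
    (x y : E) :
    ‖UnboundedOperators.heatExtension f τ x - UnboundedOperators.heatExtension f τ y‖ ≤
      (2 * C) ^ (1 - β) * ((2 : ℝ) ^ ((Module.finrank ℝ E : ℝ) / 2) * τ ^ (-(1 / 2 : ℝ)) * C) ^ β *
        ‖x - y‖ ^ β := by
  have hC0 : 0 ≤ C := (norm_nonneg _).trans (hC x)
  set K : ℝ := (2 : ℝ) ^ ((Module.finrank ℝ E : ℝ) / 2) * τ ^ (-(1 / 2 : ℝ)) * C with hK
  have hK0 : 0 ≤ K := by positivity
  -- the two bounds
  have hP : ‖UnboundedOperators.heatExtension f τ x - UnboundedOperators.heatExtension f τ y‖ ≤ 2 * C :=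
    (norm_sub_le _ _).trans (by linarith [UnboundedOperators.norm_heatExtension_le hC hτ x,
      UnboundedOperators.norm_heatExtension_le hC hτ y])
  have hQ : ‖UnboundedOperators.heatExtension f τ x - UnboundedOperators.heatExtension f τ y‖ ≤
      K * ‖x - y‖ := by
    have hmem : MemLp f ∞ volume := memLp_top_of_bound hfm C (Eventually.of_forall hC)
    rw [norm_sub_rev]
    refine (convex_univ).norm_image_sub_le_of_norm_fderiv_le (𝕜 := ℝ)
      (f := UnboundedOperators.heatExtension f τ)
      (fun w _ => ((UnboundedOperators.contDiff_heatExtension_holds hmem le_top hτ).differentiable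
        (by simp)) w) (fun w _ => ?_) (mem_univ _) (mem_univ _) |>.trans (by rw [norm_sub_rev])
    exact UnboundedOperators.norm_fderiv_heatExtension_le_of_bounded hfm hC hτ w
  rcases eq_or_ne (x - y) 0 with hxy | hxy
  · rw [sub_eq_zero.1 hxy, sub_self, norm_zero]; positivity
  have hr : 0 < ‖x - y‖ := norm_pos_iff.2 hxy
  have := le_rpow_mul_rpow_of_le_of_le (norm_nonneg _) hP hQ hβ0 hβ1
  refine this.trans (le_of_eq ?_)
  rw [Real.mul_rpow hK0 hr.le]
  ring

variable {F : Fin (Module.finrank ℝ E) → Fin (Module.finrank ℝ E) → E → ℝ}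

variable (hE : Module.finrank ℝ E = 3)
include hE

/-- **The gradient of `𝒩_τ F` on bounded data**: `‖D(𝒩_τF)ᵢ(x)‖ ≤ 2^{n/2}(τ/2)^{-1/2} · 2943 (τ/2)^{-1/2} B`
(`𝒩_τ = e^{(τ/2)Δ}𝒩_{τ/2}`). [folklore] -/
theorem norm_fderiv_oseenHeat_le_of_top (hF : ∀ j k, MemLp (F j k) ∞ volume) {B : ℝ} (hB0 : 0 ≤ B)
    (hB : ∀ j k, eLpNorm (F j k) ∞ volume ≤ ENNReal.ofReal B) {τ : ℝ} (hτ : 0 < τ)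
    (i : Fin (Module.finrank ℝ E)) (x : E) :
    ‖fderiv ℝ (oseenHeat τ F i) x‖ ≤
      (2 : ℝ) ^ ((Module.finrank ℝ E : ℝ) / 2) * (τ / 2) ^ (-(1 / 2 : ℝ)) *
        (2943 * (τ / 2) ^ (-(1 / 2 : ℝ)) * B) := by
  have h2 : 0 < τ / 2 := half_pos hτ
  have hsemi : oseenHeat τ F i = UnboundedOperators.heatExtension (oseenHeat (τ / 2) F i) (τ / 2) := by
    have := oseenHeat_eq_heatExtension hE hF h2 (show τ / 2 < τ by linarith) i
    rw [this]; congr 1; ring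
  rw [hsemi]
  exact UnboundedOperators.norm_fderiv_heatExtension_le_of_bounded
    (aestronglyMeasurable_oseenHeat hE hF h2 i) (fun w => norm_oseenHeat_le_of_top hE hF hB0 hB h2 i w)
    h2 x

/-- **Hölder modulus of `𝒩_τ F` on bounded data**: interpolating the `L^∞` bound
`2·2943 τ^{-1/2} B` and the gradient bound, `|(𝒩_τF)ᵢ(x) − (𝒩_τF)ᵢ(y)| ≤ P^{1−β} Q^β ‖x − y‖^β`
with `P = 2·2943 τ^{-1/2} B`, `Q = 2^{n/2}(τ/2)^{-1/2} 2943 (τ/2)^{-1/2} B`. [folklore] -/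
theorem norm_oseenHeat_sub_le_of_top_holder (hF : ∀ j k, MemLp (F j k) ∞ volume) {B : ℝ}
    (hB0 : 0 ≤ B) (hB : ∀ j k, eLpNorm (F j k) ∞ volume ≤ ENNReal.ofReal B) {β : ℝ} (hβ0 : 0 ≤ β)
    (hβ1 : β ≤ 1) {τ : ℝ} (hτ : 0 < τ) (i : Fin (Module.finrank ℝ E)) (x y : E) :
    ‖oseenHeat τ F i x - oseenHeat τ F i y‖ ≤
      (2 * (2943 * τ ^ (-(1 / 2 : ℝ)) * B)) ^ (1 - β) *
        ((2 : ℝ) ^ ((Module.finrank ℝ E : ℝ) / 2) * (τ / 2) ^ (-(1 / 2 : ℝ)) *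
          (2943 * (τ / 2) ^ (-(1 / 2 : ℝ)) * B)) ^ β * ‖x - y‖ ^ β := by
  set P : ℝ := 2 * (2943 * τ ^ (-(1 / 2 : ℝ)) * B) with hP
  set Q : ℝ := (2 : ℝ) ^ ((Module.finrank ℝ E : ℝ) / 2) * (τ / 2) ^ (-(1 / 2 : ℝ)) *
    (2943 * (τ / 2) ^ (-(1 / 2 : ℝ)) * B) with hQ
  have hQ0 : 0 ≤ Q := by positivity
  have h1 : ‖oseenHeat τ F i x - oseenHeat τ F i y‖ ≤ P := by
    have hx := norm_oseenHeat_le_of_top hE hF hB0 hB hτ i x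
    have hy := norm_oseenHeat_le_of_top hE hF hB0 hB hτ i y
    rw [hP]
    exact (norm_sub_le _ _).trans (by linarith)
  have h2 : ‖oseenHeat τ F i x - oseenHeat τ F i y‖ ≤ Q * ‖x - y‖ := by
    rw [norm_sub_rev]
    refine (convex_univ).norm_image_sub_le_of_norm_fderiv_le (𝕜 := ℝ) (f := oseenHeat τ F i)
      (fun w _ => ((contDiff_oseenHeat hE hF hτ i (n := 1)).differentiable one_ne_zero) w)
      (fun w _ => norm_fderiv_oseenHeat_le_of_top hE hF hB0 hB hτ i w) (mem_univ _) (mem_univ _)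
      |>.trans (by rw [norm_sub_rev])
  rcases eq_or_ne (x - y) 0 with hxy | hxy
  · rw [sub_eq_zero.1 hxy, sub_self, norm_zero]; positivity
  have hr : 0 < ‖x - y‖ := norm_pos_iff.2 hxy
  have := le_rpow_mul_rpow_of_le_of_le (norm_nonneg _) h1 h2 hβ0 hβ1
  refine this.trans (le_of_eq ?_)
  rw [Real.mul_rpow hQ0 hr.le]
  ring

end HolderModuli

/-! ### Clean power-law forms of the moduli -/

section CleanModuli

variable {E : Type*} [NormedAddCommGroup E] [InnerProductSpace ℝ E] [FiniteDimensional ℝ E]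
  [MeasurableSpace E] [BorelSpace E]
variable {F' : Type*} [NormedAddCommGroup F'] [NormedSpace ℝ F'] [CompleteSpace F']

/-- `(2C)^{1−β}(κ τ^{-1/2} C)^β = 2^{1−β} κ^β C τ^{-β/2}`. [folklore] -/
theorem heat_holder_const_eq {C κ τ β : ℝ} (hC : 0 ≤ C) (hκ : 0 ≤ κ) (hτ : 0 < τ) :
    (2 * C) ^ (1 - β) * (κ * τ ^ (-(1 / 2 : ℝ)) * C) ^ β =
      (2 : ℝ) ^ (1 - β) * κ ^ β * C * τ ^ (-(β / 2)) := by
  have hτ' : 0 ≤ τ ^ (-(1 / 2 : ℝ)) := Real.rpow_nonneg hτ.le _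
  rw [Real.mul_rpow zero_le_two hC, Real.mul_rpow (mul_nonneg hκ hτ') hC, Real.mul_rpow hκ hτ',
    ← Real.rpow_mul hτ.le, show -(1 / 2 : ℝ) * β = -(β / 2) by ring]
  rcases hC.eq_or_lt with h0 | hCpos
  · rw [← h0]
    rcases eq_or_ne β 0 with hb | hb
    · subst hb; simp
    · rw [Real.zero_rpow hb]; ring
  have : C ^ (1 - β) * C ^ β = C := by
    rw [← Real.rpow_add hCpos, show (1 - β) + β = 1 by ring, Real.rpow_one]
  calc _ = (2 : ℝ) ^ (1 - β) * κ ^ β * τ ^ (-(β / 2)) * (C ^ (1 - β) * C ^ β) := by ring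
    _ = _ := by rw [this]; ring

/-- **Hölder modulus of the heat flow, power-law form**:
`‖e^{τΔ}f(x) − e^{τΔ}f(y)‖ ≤ 2^{1−β}(2^{n/2})^β C τ^{-β/2}‖x − y‖^β`. [folklore] -/
theorem norm_heatExtension_sub_le_holder {f : E → F'} (hfm : AEStronglyMeasurable f volume)
    {C : ℝ} (hC : ∀ z, ‖f z‖ ≤ C) {β : ℝ} (hβ0 : 0 ≤ β) (hβ1 : β ≤ 1) {τ : ℝ} (hτ : 0 < τ)
    (x y : E) :
    ‖UnboundedOperators.heatExtension f τ x - UnboundedOperators.heatExtension f τ y‖ ≤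
      (2 : ℝ) ^ (1 - β) * ((2 : ℝ) ^ ((Module.finrank ℝ E : ℝ) / 2)) ^ β * C * τ ^ (-(β / 2)) *
        ‖x - y‖ ^ β := by
  have hC0 : 0 ≤ C := (norm_nonneg _).trans (hC x)
  have := norm_heatExtension_sub_le_of_bound_holder hfm hC hβ0 hβ1 hτ x y
  rwa [heat_holder_const_eq hC0 (by positivity) hτ] at this

variable {F : Fin (Module.finrank ℝ E) → Fin (Module.finrank ℝ E) → E → ℝ}
variable (hE : Module.finrank ℝ E = 3)
include hE

/-- **Hölder modulus of `𝒩_τ F`, power-law form**: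
`|(𝒩_τF)ᵢ(x) − (𝒩_τF)ᵢ(y)| ≤ 2^{1−β}(2·2^{n/2})^β · 2943 B τ^{-(1+β)/2}‖x − y‖^β`. [folklore] -/
theorem norm_oseenHeat_sub_le_holder (hF : ∀ j k, MemLp (F j k) ∞ volume) {B : ℝ} (hB0 : 0 ≤ B)
    (hB : ∀ j k, eLpNorm (F j k) ∞ volume ≤ ENNReal.ofReal B) {β : ℝ} (hβ0 : 0 ≤ β) (hβ1 : β ≤ 1)
    {τ : ℝ} (hτ : 0 < τ) (i : Fin (Module.finrank ℝ E)) (x y : E) :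
    ‖oseenHeat τ F i x - oseenHeat τ F i y‖ ≤
      (2 : ℝ) ^ (1 - β) * (2 * (2 : ℝ) ^ ((Module.finrank ℝ E : ℝ) / 2)) ^ β * (2943 * B) *
        τ ^ (-((1 + β) / 2)) * ‖x - y‖ ^ β := by
  have h := norm_oseenHeat_sub_le_of_top_holder hE hF hB0 hB hβ0 hβ1 hτ i x y
  -- rewrite `(τ/2)^{-1/2}(τ/2)^{-1/2} = 2 τ^{-1}` inside `Q`
  have hQ : (2 : ℝ) ^ ((Module.finrank ℝ E : ℝ) / 2) * (τ / 2) ^ (-(1 / 2 : ℝ)) *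
      (2943 * (τ / 2) ^ (-(1 / 2 : ℝ)) * B) =
      (2 * (2 : ℝ) ^ ((Module.finrank ℝ E : ℝ) / 2)) * τ ^ (-(1 / 2 : ℝ)) * (2943 * B) *
        τ ^ (-(1 / 2 : ℝ)) := by
    have h2 : 0 < τ / 2 := half_pos hτ
    have hh : (τ / 2) ^ (-(1 / 2 : ℝ)) * (τ / 2) ^ (-(1 / 2 : ℝ)) = 2 * τ ^ (-(1 : ℝ)) := by
      rw [← Real.rpow_add h2, show -(1 / 2 : ℝ) + -(1 / 2) = -1 by norm_num,
        Real.rpow_neg h2.le, Real.rpow_neg hτ.le, Real.rpow_one, Real.rpow_one]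
      field_simp
    have hh' : τ ^ (-(1 / 2 : ℝ)) * τ ^ (-(1 / 2 : ℝ)) = τ ^ (-(1 : ℝ)) := by
      rw [← Real.rpow_add hτ]; norm_num
    calc _ = (2 : ℝ) ^ ((Module.finrank ℝ E : ℝ) / 2) * (2943 * B) *
          ((τ / 2) ^ (-(1 / 2 : ℝ)) * (τ / 2) ^ (-(1 / 2 : ℝ))) := by ring
      _ = _ := by rw [hh, ← hh']; ring
  rw [hQ] at h
  -- now `P = 2·(2943 B) τ^{-1/2}` and `Q = K τ^{-1/2}·(2943B)·τ^{-1/2}`: interpolate the powers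
  have hP : 2 * (2943 * τ ^ (-(1 / 2 : ℝ)) * B) = 2 * (2943 * B) * τ ^ (-(1 / 2 : ℝ)) := by ring
  rw [hP] at h
  refine h.trans (le_of_eq ?_)
  set K : ℝ := 2 * (2 : ℝ) ^ ((Module.finrank ℝ E : ℝ) / 2) with hK
  set M : ℝ := 2943 * B with hM
  have hK0 : 0 ≤ K := by positivity
  have hM0 : 0 ≤ M := by positivity
  -- reduce to the scalar identity `heat_holder_const_eq` with `C := M τ^{-1/2}`, `κ := K`
  have hMt : 0 ≤ M * τ ^ (-(1 / 2 : ℝ)) := mul_nonneg hM0 (Real.rpow_nonneg hτ.le _)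
  have key := heat_holder_const_eq (C := M * τ ^ (-(1 / 2 : ℝ))) (κ := K) (β := β) hMt hK0 hτ
  have lhs : (2 * M * τ ^ (-(1 / 2 : ℝ))) ^ (1 - β) *
      (K * τ ^ (-(1 / 2 : ℝ)) * M * τ ^ (-(1 / 2 : ℝ))) ^ β =
      (2 * (M * τ ^ (-(1 / 2 : ℝ)))) ^ (1 - β) *
        (K * τ ^ (-(1 / 2 : ℝ)) * (M * τ ^ (-(1 / 2 : ℝ)))) ^ β := by ring_nf
  have rhs : (2 : ℝ) ^ (1 - β) * K ^ β * (M * τ ^ (-(1 / 2 : ℝ))) * τ ^ (-(β / 2)) =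
      (2 : ℝ) ^ (1 - β) * K ^ β * M * τ ^ (-((1 + β) / 2)) := by
    rw [show (2 : ℝ) ^ (1 - β) * K ^ β * (M * τ ^ (-(1 / 2 : ℝ))) * τ ^ (-(β / 2)) =
      (2 : ℝ) ^ (1 - β) * K ^ β * M * (τ ^ (-(1 / 2 : ℝ)) * τ ^ (-(β / 2))) by ring,
      ← Real.rpow_add hτ]
    congr 2; ring
  rw [lhs, key, rhs]

end CleanModuli

/-! ### Level ½: Hölder continuity of the slices of a restarted-mild field -/

section HolderSlice

variable {E : Type*} [NormedAddCommGroup E] [InnerProductSpace ℝ E] [FiniteDimensional ℝ E]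
  [MeasurableSpace E] [BorelSpace E]

omit [MeasurableSpace E] [BorelSpace E] in
/-- Hölder constant of the tensor `V ⊗ V` from a bound and a Hölder bound on `V`:
`|Fⱼₖ(y) − Fⱼₖ(z)| ≤ 2 N A ‖y − z‖^β`. [folklore] -/
theorem abs_driftTensor_zero_sub_le {V : ℝ → E → E} {N A β σ : ℝ} (hN : ∀ y, ‖V σ y‖ ≤ N)
    (hA : ∀ y z, ‖V σ y - V σ z‖ ≤ A * ‖y - z‖ ^ β) (j k : Fin (Module.finrank ℝ E)) (y z : E) :
    |driftTensor V 0 σ j k y - driftTensor V 0 σ j k z| ≤ 2 * N * A * ‖y - z‖ ^ β := by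
  rw [IsKNSSDriftMild.driftTensor_zero_apply, IsKNSSDriftMild.driftTensor_zero_apply]
  set e := stdOrthonormalBasis ℝ E
  have hsplit : ⟪V σ y, e j⟫ * ⟪V σ y, e k⟫ - ⟪V σ z, e j⟫ * ⟪V σ z, e k⟫ =
      ⟪V σ y - V σ z, e j⟫ * ⟪V σ y, e k⟫ + ⟪V σ z, e j⟫ * ⟪V σ y - V σ z, e k⟫ := by
    rw [inner_sub_left, inner_sub_left]; ring
  rw [hsplit]
  have h1 := abs_inner_stdOrthonormalBasis_le (V σ y - V σ z) j
  have h2 := abs_inner_stdOrthonormalBasis_le (V σ y) k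
  have h3 := abs_inner_stdOrthonormalBasis_le (V σ z) j
  have h4 := abs_inner_stdOrthonormalBasis_le (V σ y - V σ z) k
  have hA0 : 0 ≤ A * ‖y - z‖ ^ β := (norm_nonneg _).trans (hA y z)
  calc _ ≤ |⟪V σ y - V σ z, e j⟫ * ⟪V σ y, e k⟫| + |⟪V σ z, e j⟫ * ⟪V σ y - V σ z, e k⟫| :=
        abs_add_le _ _
    _ ≤ (A * ‖y - z‖ ^ β) * N + N * (A * ‖y - z‖ ^ β) := by
        rw [abs_mul, abs_mul]
        exact add_le_add (mul_le_mul (h1.trans (hA y z)) (h2.trans (hN y)) (abs_nonneg _) hA0)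
          (mul_le_mul (h3.trans (hN z)) (h4.trans (hA y z)) (abs_nonneg _)
            ((norm_nonneg _).trans (hN z)))
    _ = 2 * N * A * ‖y - z‖ ^ β := by ring

/-- `∫ₛᵗ (t − σ)^{p} dσ = (t − s)^{p+1}/(p + 1)` for `p > −1`, `s ≤ t`. [folklore] -/
theorem integral_rpow_sub_left_eq {s t p : ℝ} (hp : -1 < p) :
    ∫ σ in s..t, (t - σ) ^ p = (t - s) ^ (p + 1) / (p + 1) := by
  rw [intervalIntegral.integral_comp_sub_left (fun σ => σ ^ p) t, sub_self,
    integral_rpow (Or.inl hp), Real.zero_rpow (by linarith : p + 1 ≠ 0), sub_zero]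

variable {T N : ℝ} {V : ℝ → E → E}
variable (hE : Module.finrank ℝ E = 3)
include hE

/-- **Level ½ — Hölder continuity of the slices of a restarted-mild field** (`b ≡ 0`): for
`0 < s < t < T`, `0 ≤ β < 1`,
`‖V(t,x) − V(t,y)‖ ≤ (2^{1−β}κ^β N (t − s)^{-β/2} + 3·K_β·2943·4N²·(t − s)^{(1−β)/2}/((1−β)/2)) ‖x − y‖^β`
(`κ = 2^{n/2}`, `K_β = 2^{1−β}(2κ)^β`): the heat part by `norm_heatExtension_sub_le_holder`, the
Duhamel part by integrating `norm_oseenHeat_sub_le_holder` in `σ`. [cite: KochNadirashviliSereginSverak2009, §4 Prop. 4.1, step towards (4.6) (arXiv:0709.3599v1 p. 8)] -/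
theorem IsKNSSDriftMild.norm_slice_sub_le_holder (h : IsKNSSDriftMild T N V 0) {β : ℝ}
    (hβ0 : 0 ≤ β) (hβ1 : β < 1) {s t : ℝ} (hs : 0 < s) (hst : s < t) (ht : t < T) (x y : E) :
    ‖V t x - V t y‖ ≤
      ((2 : ℝ) ^ (1 - β) * ((2 : ℝ) ^ ((Module.finrank ℝ E : ℝ) / 2)) ^ β * N *
          (t - s) ^ (-(β / 2)) +
        3 * ((2 : ℝ) ^ (1 - β) * (2 * (2 : ℝ) ^ ((Module.finrank ℝ E : ℝ) / 2)) ^ β *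
          (2943 * (4 * N ^ 2))) * ((t - s) ^ ((1 - β) / 2) / ((1 - β) / 2))) *
        ‖x - y‖ ^ β := by
  have hT : 0 < T := hs.trans (hst.trans ht)
  have hsT : s ∈ Ioo 0 T := ⟨hs, hst.trans ht⟩
  have hN : 0 ≤ N := h.nonneg
  have hd : 0 < t - s := sub_pos.2 hst
  set KH : ℝ := (2 : ℝ) ^ (1 - β) * ((2 : ℝ) ^ ((Module.finrank ℝ E : ℝ) / 2)) ^ β * N with hKH
  set KD : ℝ := (2 : ℝ) ^ (1 - β) * (2 * (2 : ℝ) ^ ((Module.finrank ℝ E : ℝ) / 2)) ^ β *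
    (2943 * (4 * N ^ 2)) with hKD
  have hKD0 : 0 ≤ KD := by positivity
  -- the mild identity at `x` and `y`
  rw [h.mild s t hs hst ht x, h.mild s t hs hst ht y]
  have hVs : AEStronglyMeasurable (V s) volume :=
    (h.measurable.comp (measurable_const.prodMk measurable_id)).aestronglyMeasurable
  -- heat part
  have hheat := norm_heatExtension_sub_le_holder hVs (fun z => h.norm_le s hsT z) hβ0 hβ1.le hd x y
  -- Duhamel part
  set G : ℝ → E → E := fun σ w => ∑ i, oseenHeat (t - σ) (driftTensor V 0 σ) i w •
    stdOrthonormalBasis ℝ E i with hG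
  have hB : ∀ σ ∈ Ioo s t, ∀ j k w, |driftTensor V 0 σ j k w| ≤ 4 * N ^ 2 := fun σ hσ j k w =>
    h.abs_driftTensor_le ⟨hs.trans hσ.1, hσ.2.trans ht⟩ j k w
  have hI : ∀ w, IntervalIntegrable (fun σ => G σ w) volume s t := fun w =>
    intervalIntegrable_sum_oseenHeat_sub_smul hE h.measurable_driftTensor (by positivity) hst.le hB w
  have hDsub : driftDuhamel V 0 s t x - driftDuhamel V 0 s t y = ∫ σ in s..t, (G σ x - G σ y) := by
    rw [driftDuhamel_apply, driftDuhamel_apply, ← intervalIntegral.integral_sub (hI x) (hI y)]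
  -- pointwise bound of the integrand
  have hpt : ∀ σ ∈ Ioo s t, ‖G σ x - G σ y‖ ≤
      3 * KD * (t - σ) ^ (-((1 + β) / 2)) * ‖x - y‖ ^ β := by
    intro σ hσ
    have hσT : σ ∈ Ioo 0 T := ⟨hs.trans hσ.1, hσ.2.trans ht⟩
    have hmem := fun j k => memLp_top_slice_of_bound (F := fun σ => driftTensor V 0 σ)
      h.measurable_driftTensor (σ := σ) (fun j k w => h.abs_driftTensor_le hσT j k w) j k
    have hcomp : ∀ i, ‖oseenHeat (t - σ) (driftTensor V 0 σ) i x -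
        oseenHeat (t - σ) (driftTensor V 0 σ) i y‖ ≤ KD * (t - σ) ^ (-((1 + β) / 2)) * ‖x - y‖ ^ β :=
      fun i => norm_oseenHeat_sub_le_holder hE (fun j k => (hmem j k).1) (by positivity)
        (fun j k => (hmem j k).2) hβ0 hβ1.le (sub_pos.2 hσ.2) i x y
    have hsum : G σ x - G σ y = ∑ i, (oseenHeat (t - σ) (driftTensor V 0 σ) i x -
        oseenHeat (t - σ) (driftTensor V 0 σ) i y) • stdOrthonormalBasis ℝ E i := by
      simp only [hG, sub_smul, Finset.sum_sub_distrib]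
    rw [hsum]
    refine (norm_sum_smul_stdOrthonormalBasis_le _).trans ?_
    calc ∑ i, |oseenHeat (t - σ) (driftTensor V 0 σ) i x - oseenHeat (t - σ) (driftTensor V 0 σ) i y|
        ≤ ∑ _i : Fin (Module.finrank ℝ E), KD * (t - σ) ^ (-((1 + β) / 2)) * ‖x - y‖ ^ β :=
          Finset.sum_le_sum fun i _ => by rw [← Real.norm_eq_abs]; exact hcomp i
      _ = 3 * KD * (t - σ) ^ (-((1 + β) / 2)) * ‖x - y‖ ^ β := by
          rw [Finset.sum_const, Finset.card_univ, Fintype.card_fin, hE, nsmul_eq_mul]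
          push_cast; ring
  -- integrate the bound
  have hp : (-1 : ℝ) < -((1 + β) / 2) := by linarith
  have hgi : IntervalIntegrable (fun σ => 3 * KD * (t - σ) ^ (-((1 + β) / 2)) * ‖x - y‖ ^ β)
      volume s t := by
    have := ((intervalIntegral.intervalIntegrable_rpow' (a := t - s) (b := 0) hp).comp_sub_left t)
    have h' : IntervalIntegrable (fun σ => (t - σ) ^ (-((1 + β) / 2))) volume s t := by simpa using this
    exact (h'.const_mul (3 * KD)).mul_const _
  have hDle : ‖driftDuhamel V 0 s t x - driftDuhamel V 0 s t y‖ ≤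
      3 * KD * ((t - s) ^ ((1 - β) / 2) / ((1 - β) / 2)) * ‖x - y‖ ^ β := by
    rw [hDsub]
    refine (intervalIntegral.norm_integral_le_of_norm_le hst.le (ae_mem_Ioc_of_forall_Ioo hpt)
      hgi).trans (le_of_eq ?_)
    rw [intervalIntegral.integral_mul_const, intervalIntegral.integral_const_mul,
      integral_rpow_sub_left_eq hp, show -((1 + β) / 2) + 1 = (1 - β) / 2 by ring]
  calc ‖UnboundedOperators.heatExtension (V s) (t - s) x - driftDuhamel V 0 s t x -
        (UnboundedOperators.heatExtension (V s) (t - s) y - driftDuhamel V 0 s t y)‖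
      = ‖(UnboundedOperators.heatExtension (V s) (t - s) x -
            UnboundedOperators.heatExtension (V s) (t - s) y) -
          (driftDuhamel V 0 s t x - driftDuhamel V 0 s t y)‖ := by congr 1; abel
    _ ≤ _ := norm_sub_le _ _
    _ ≤ KH * (t - s) ^ (-(β / 2)) * ‖x - y‖ ^ β +
          3 * KD * ((t - s) ^ ((1 - β) / 2) / ((1 - β) / 2)) * ‖x - y‖ ^ β := add_le_add hheat hDle
    _ = _ := by ring

end HolderSlice

/-! ### Gradient of `𝒩_τ F` on Hölder data (power form) and measurability of `σ ↦ D(𝒩_{t−σ}F(σ))` -/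

section GradTools

variable {E : Type*} [NormedAddCommGroup E] [InnerProductSpace ℝ E] [FiniteDimensional ℝ E]
  [MeasurableSpace E] [BorelSpace E]

/-- Product weights are interval integrable: `σ ↦ (t − σ)^{-a}(σ − s)^{-b}` on `[s, t]` for
`a, b < 1`. [folklore] -/
theorem intervalIntegrable_rpow_neg_mul_rpow_neg {a b s t : ℝ} (ha1 : a < 1) (hb1 : b < 1)
    (hst : s < t) :
    IntervalIntegrable (fun σ => (t - σ) ^ (-a) * (σ - s) ^ (-b)) volume s t := by
  set m : ℝ := (s + t) / 2 with hm
  have hsm : s < m := by rw [hm]; linarith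
  have hmt : m < t := by rw [hm]; linarith
  have hleft : IntervalIntegrable (fun σ => (t - σ) ^ (-a) * (σ - s) ^ (-b)) volume s m := by
    have hi1 : IntervalIntegrable (fun σ => (σ - s) ^ (-b)) volume s m := by
      have := (intervalIntegral.intervalIntegrable_rpow' (a := 0) (b := m - s)
        (by linarith : (-1 : ℝ) < -b)).comp_sub_right s
      simpa using this
    refine hi1.continuousOn_mul ?_
    rw [uIcc_of_le hsm.le]
    exact (continuousOn_const.sub continuousOn_id).rpow_const fun σ hσ =>
      Or.inl (by linarith [hσ.2] : t - σ ≠ 0)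
  have hright : IntervalIntegrable (fun σ => (t - σ) ^ (-a) * (σ - s) ^ (-b)) volume m t := by
    have hi2 : IntervalIntegrable (fun σ => (t - σ) ^ (-a)) volume m t := by
      have := (intervalIntegral.intervalIntegrable_rpow' (a := t - m) (b := 0)
        (by linarith : (-1 : ℝ) < -a)).comp_sub_left t
      simpa using this
    refine hi2.mul_continuousOn ?_
    rw [uIcc_of_le hmt.le]
    exact (continuousOn_id.sub continuousOn_const).rpow_const fun σ hσ =>
      Or.inl (by linarith [hσ.1] : σ - s ≠ 0)
  exact hleft.trans hright

variable {F : Fin (Module.finrank ℝ E) → Fin (Module.finrank ℝ E) → E → ℝ}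
variable (hE : Module.finrank ℝ E = 3)
include hE

/-- **Gradient of `𝒩_τ F` on Hölder data, power form**:
`‖D(𝒩_τF)ᵢ(x)‖ ≤ 2κ(1 + 2κ)·2^{β/2}·2943 · A · τ^{β/2 − 1}` (`κ = 2^{n/2}`). [folklore] -/
theorem norm_fderiv_oseenHeat_le_holder (hF : ∀ j k, MemLp (F j k) ∞ volume) {B : ℝ}
    (hB0 : 0 ≤ B) (hB : ∀ j k, eLpNorm (F j k) ∞ volume ≤ ENNReal.ofReal B) {A β : ℝ} (hA : 0 ≤ A)
    (hβ0 : 0 ≤ β) (hβ1 : β ≤ 1) (hH : ∀ j k y z, |F j k y - F j k z| ≤ A * ‖y - z‖ ^ β)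
    {τ : ℝ} (hτ : 0 < τ) (i : Fin (Module.finrank ℝ E)) (x : E) :
    ‖fderiv ℝ (oseenHeat τ F i) x‖ ≤
      2 * (2 : ℝ) ^ ((Module.finrank ℝ E : ℝ) / 2) * (1 + 2 * (2 : ℝ) ^ ((Module.finrank ℝ E : ℝ) / 2)) *
        2943 * A * τ ^ (β / 2 - 1) := by
  have h := norm_fderiv_oseenHeat_le_of_holder hE hF hB0 hB hA hβ0 hβ1 hH hτ i x
  refine h.trans (le_of_eq ?_)
  set κ : ℝ := (2 : ℝ) ^ ((Module.finrank ℝ E : ℝ) / 2)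
  have h2 : 0 < τ / 2 := half_pos hτ
  rw [show 2 * (τ / 2) = τ by ring]
  have e1 : (τ / 2) ^ (-(1 / 2 : ℝ)) * (τ / 2) ^ (-(1 / 2 : ℝ)) = 2 * τ ^ (-(1 : ℝ)) := by
    rw [← Real.rpow_add h2, show -(1 / 2 : ℝ) + -(1 / 2) = -1 by norm_num,
      Real.rpow_neg h2.le, Real.rpow_neg hτ.le, Real.rpow_one, Real.rpow_one]
    field_simp
  have e2 : τ ^ (-(1 : ℝ)) * τ ^ (β / 2) = τ ^ (β / 2 - 1) := by
    rw [← Real.rpow_add hτ]; congr 1; ring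
  calc κ * (τ / 2) ^ (-(1 / 2 : ℝ)) * ((1 + 2 * κ) * τ ^ (β / 2)) *
        (2943 * (τ / 2) ^ (-(1 / 2 : ℝ)) * A)
      = κ * (1 + 2 * κ) * 2943 * A * ((τ / 2) ^ (-(1 / 2 : ℝ)) * (τ / 2) ^ (-(1 / 2 : ℝ))) *
          τ ^ (β / 2) := by ring
    _ = 2 * κ * (1 + 2 * κ) * 2943 * A * (τ ^ (-(1 : ℝ)) * τ ^ (β / 2)) := by rw [e1]; ring
    _ = _ := by rw [e2]

omit [MeasurableSpace E] [BorelSpace E] hE in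
/-- A continuous linear functional on `E` in the frame: `L = ∑ₗ L(eₗ) • ⟪eₗ, ·⟫`. [folklore] -/
theorem clm_eq_sum_smul_innerSL (L : E →L[ℝ] ℝ) :
    L = ∑ l, L (stdOrthonormalBasis ℝ E l) • innerSL ℝ (stdOrthonormalBasis ℝ E l) := by
  ext v
  simp only [FunLike.coe_sum, FunLike.coe_smul, Finset.sum_apply,
    Pi.smul_apply, innerSL_apply_apply, smul_eq_mul]
  conv_lhs => rw [← (stdOrthonormalBasis ℝ E).sum_repr' v]
  rw [map_sum]
  refine Finset.sum_congr rfl fun l _ => ?_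
  rw [map_smul, smul_eq_mul, mul_comm]

variable {G : ℝ → Fin (Module.finrank ℝ E) → Fin (Module.finrank ℝ E) → E → ℝ}

/-- **Measurability of the gradient of the Duhamel integrand in the time variable**: for a jointly
measurable forcing bounded by `B` on `(s, t)`, `σ ↦ D(𝒩_{t−σ}G(σ))ᵢ(x)` is a.e. strongly measurable
on `(s, t)` (difference quotients along the frame vectors converge for `σ < t`; a functional is the
frame combination of its values). [folklore] -/
theorem aestronglyMeasurable_fderiv_oseenHeat_sub
    (hmeas : ∀ j k, Measurable fun q : ℝ × E => G q.1 j k q.2) {B : ℝ} {s t : ℝ}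
    (hB : ∀ σ ∈ Ioo s t, ∀ j k y, |G σ j k y| ≤ B) (i : Fin (Module.finrank ℝ E)) (x : E) :
    AEStronglyMeasurable (fun σ => fderiv ℝ (oseenHeat (t - σ) (G σ) i) x)
      ((volume : Measure ℝ).restrict (Ioo s t)) := by
  set e := stdOrthonormalBasis ℝ E
  have hrepr : (fun σ => fderiv ℝ (oseenHeat (t - σ) (G σ) i) x) = fun σ =>
      ∑ l, fderiv ℝ (oseenHeat (t - σ) (G σ) i) x (e l) • innerSL ℝ (e l) := by
    funext σ; exact clm_eq_sum_smul_innerSL _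
  rw [hrepr]
  refine Finset.aestronglyMeasurable_fun_sum _ fun l _ => AEStronglyMeasurable.smul_const ?_ _
  -- the partial derivative along `e l` is the limit of difference quotients
  have hq : ∀ n : ℕ, AEStronglyMeasurable
      (fun σ => ((n : ℝ) + 1) * (oseenHeat (t - σ) (G σ) i (x + ((n : ℝ) + 1)⁻¹ • e l) -
        oseenHeat (t - σ) (G σ) i x)) ((volume : Measure ℝ).restrict (Ioo s t)) := fun n =>
    (((aestronglyMeasurable_oseenHeat_sub_section hE hmeas measurableSet_Ioo (fun σ hσ => hσ.2) hB
      i (x + ((n : ℝ) + 1)⁻¹ • e l)).sub (aestronglyMeasurable_oseenHeat_sub_section hE hmeas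
      measurableSet_Ioo (fun σ hσ => hσ.2) hB i x)).const_mul _)
  refine aestronglyMeasurable_of_tendsto_ae atTop hq ?_
  refine (ae_restrict_iff' measurableSet_Ioo).2 (Eventually.of_forall fun σ hσ => ?_)
  have hmem := fun j k => memLp_top_slice_of_bound hmeas (σ := σ) (hB σ hσ) j k
  have hdiff : HasFDerivAt (oseenHeat (t - σ) (G σ) i) (fderiv ℝ (oseenHeat (t - σ) (G σ) i) x) x :=
    (((contDiff_oseenHeat hE (fun j k => (hmem j k).1) (sub_pos.2 hσ.2) i (n := 1)).differentiable
      one_ne_zero) x).hasFDerivAt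
  have hseq : Tendsto (fun n : ℕ => (n : ℝ) + 1) atTop atTop :=
    tendsto_natCast_atTop_atTop.atTop_add tendsto_const_nhds
  have hlim := (hdiff.lim_real (e l)).comp hseq
  simpa [smul_eq_mul, Function.comp_def] using hlim

end GradTools

/-! ### Differentiating the Duhamel integral in `x` on Hölder forcing -/

section DuhamelGrad

variable {E : Type*} [NormedAddCommGroup E] [InnerProductSpace ℝ E] [FiniteDimensional ℝ E]
  [MeasurableSpace E] [BorelSpace E]

variable {G : ℝ → Fin (Module.finrank ℝ E) → Fin (Module.finrank ℝ E) → E → ℝ}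
variable (hE : Module.finrank ℝ E = 3)
include hE

/-- Pointwise majorant of the derivative of the Duhamel integrand on Hölder forcing:
`‖∑ᵢ D(𝒩_{t−σ}G(σ))ᵢ(w) ⊗ eᵢ‖ ≤ 3·(2κ(1+2κ)2943 · A(σ) (t − σ)^{β/2−1})`. [folklore] -/
theorem norm_sum_fderiv_oseenHeat_smulRight_le
    (hmeas : ∀ j k, Measurable fun q : ℝ × E => G q.1 j k q.2) {B : ℝ} (hB0 : 0 ≤ B) {s t : ℝ}
    (hB : ∀ σ ∈ Ioo s t, ∀ j k y, |G σ j k y| ≤ B) {A : ℝ → ℝ} {β : ℝ}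
    (hβ0 : 0 ≤ β) (hβ1 : β ≤ 1) (hA0 : ∀ σ ∈ Ioo s t, 0 ≤ A σ)
    (hH : ∀ σ ∈ Ioo s t, ∀ j k y z, |G σ j k y - G σ j k z| ≤ A σ * ‖y - z‖ ^ β)
    {σ : ℝ} (hσ : σ ∈ Ioo s t) (w : E) :
    ‖∑ i, (fderiv ℝ (oseenHeat (t - σ) (G σ) i) w).smulRight (stdOrthonormalBasis ℝ E i)‖ ≤
      3 * ((2 * (2 : ℝ) ^ ((Module.finrank ℝ E : ℝ) / 2) *
        (1 + 2 * (2 : ℝ) ^ ((Module.finrank ℝ E : ℝ) / 2)) * 2943) * A σ * (t - σ) ^ (β / 2 - 1)) := by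
  set e := stdOrthonormalBasis ℝ E
  set κ : ℝ := (2 : ℝ) ^ ((Module.finrank ℝ E : ℝ) / 2) with hκ
  set K : ℝ := 2 * κ * (1 + 2 * κ) * 2943 with hK
  have hK0 : 0 ≤ K := by positivity
  have hmem := fun j k => memLp_top_slice_of_bound hmeas (σ := σ) (hB σ hσ) j k
  refine (norm_sum_le _ _).trans ?_
  have hcomp : ∀ i, ‖(fderiv ℝ (oseenHeat (t - σ) (G σ) i) w).smulRight (e i)‖ ≤
      K * A σ * (t - σ) ^ (β / 2 - 1) := by
    intro i
    rw [ContinuousLinearMap.norm_smulRight_apply]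
    have h1 := norm_fderiv_oseenHeat_le_holder hE (fun j k => (hmem j k).1) hB0
      (fun j k => (hmem j k).2) (hA0 σ hσ) hβ0 hβ1 (hH σ hσ) (sub_pos.2 hσ.2) i w
    have he : ‖e i‖ ≤ 1 := norm_stdOrthonormalBasis_le_one i
    calc _ ≤ (K * A σ * (t - σ) ^ (β / 2 - 1)) * 1 :=
          mul_le_mul (by rw [hK]; linarith) he (norm_nonneg _)
            (mul_nonneg (mul_nonneg hK0 (hA0 σ hσ)) (Real.rpow_nonneg (sub_pos.2 hσ.2).le _))
      _ = _ := mul_one _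
  calc ∑ i, ‖(fderiv ℝ (oseenHeat (t - σ) (G σ) i) w).smulRight (e i)‖
      ≤ ∑ _i : Fin (Module.finrank ℝ E), K * A σ * (t - σ) ^ (β / 2 - 1) :=
        Finset.sum_le_sum fun i _ => hcomp i
    _ = 3 * (K * A σ * (t - σ) ^ (β / 2 - 1)) := by
        rw [Finset.sum_const, Finset.card_univ, Fintype.card_fin, hE, nsmul_eq_mul]; push_cast; ring

/-- **The Duhamel integral is differentiable in `x` on Hölder forcing**, with derivative the
integral of the derivatives: for a jointly measurable forcing bounded by `B` on `(s, t)` whose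
slices are `β`-Hölder with constants `A(σ)` such that `σ ↦ A(σ)(t − σ)^{β/2−1}` is integrable,
`x ↦ ∫ₛᵗ 𝒩_{t−σ}G(σ)(x) dσ` has the Fréchet derivative `∫ₛᵗ D(𝒩_{t−σ}G(σ))(x) dσ`
(dominated differentiation, majorant `3·2κ(1+2κ)2^{β/2}2943 · A(σ)(t − σ)^{β/2−1}`). [folklore] -/
theorem hasFDerivAt_integral_sum_oseenHeat_duhamel
    (hmeas : ∀ j k, Measurable fun q : ℝ × E => G q.1 j k q.2) {B : ℝ} (hB0 : 0 ≤ B) {s t : ℝ}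
    (hst : s < t) (hB : ∀ σ ∈ Ioo s t, ∀ j k y, |G σ j k y| ≤ B) {A : ℝ → ℝ} {β : ℝ}
    (hβ0 : 0 ≤ β) (hβ1 : β ≤ 1) (hA0 : ∀ σ ∈ Ioo s t, 0 ≤ A σ)
    (hH : ∀ σ ∈ Ioo s t, ∀ j k y z, |G σ j k y - G σ j k z| ≤ A σ * ‖y - z‖ ^ β)
    (hAi : IntervalIntegrable (fun σ => A σ * (t - σ) ^ (β / 2 - 1)) volume s t) (x : E) :
    HasFDerivAt (fun x => ∫ σ in s..t, ∑ i, oseenHeat (t - σ) (G σ) i x • stdOrthonormalBasis ℝ E i)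
      (∫ σ in s..t, ∑ i, (fderiv ℝ (oseenHeat (t - σ) (G σ) i) x).smulRight
        (stdOrthonormalBasis ℝ E i)) x := by
  set e := stdOrthonormalBasis ℝ E
  set κ : ℝ := (2 : ℝ) ^ ((Module.finrank ℝ E : ℝ) / 2) with hκ
  set K : ℝ := 2 * κ * (1 + 2 * κ) * 2943 with hK
  have hK0 : 0 ≤ K := by positivity
  have hΙ : Ι s t = Ioc s t := uIoc_of_le hst.le
  have hμ : (volume : Measure ℝ).restrict (Ioo s t) = volume.restrict (Ioc s t) :=
    Measure.restrict_congr_set Ioo_ae_eq_Ioc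
  have hI : ∀ w, IntervalIntegrable (fun σ => ∑ i, oseenHeat (t - σ) (G σ) i w • e i) volume s t :=
    fun w => intervalIntegrable_sum_oseenHeat_sub_smul hE hmeas hB0 hst.le hB w
  refine hasFDerivAt_integral_of_dominated_of_fderiv_le'' (μ := volume) (s := univ) (x₀ := x)
    (a := s) (b := t) (F := fun w σ => ∑ i, oseenHeat (t - σ) (G σ) i w • e i)
    (F' := fun w σ => ∑ i, (fderiv ℝ (oseenHeat (t - σ) (G σ) i) w).smulRight (e i))
    (bound := fun σ => 3 * (K * A σ * (t - σ) ^ (β / 2 - 1))) univ_mem ?_ (hI x) ?_ ?_ ?_ ?_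
  · exact Eventually.of_forall fun w => by rw [hΙ]; exact (hI w).1.aestronglyMeasurable
  · rw [hΙ, ← hμ]
    refine Finset.aestronglyMeasurable_fun_sum _ fun i _ => ?_
    have hm := aestronglyMeasurable_fderiv_oseenHeat_sub hE hmeas hB i x
    exact ((ContinuousLinearMap.smulRightL ℝ E E).flip (e i)).continuous.comp_aestronglyMeasurable hm
  · rw [hΙ, ← hμ]
    refine (ae_restrict_iff' measurableSet_Ioo).2 (Eventually.of_forall fun σ hσ w _ => ?_)
    exact norm_sum_fderiv_oseenHeat_smulRight_le hE hmeas hB0 hB hβ0 hβ1 hA0 hH hσ w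
  · have : IntervalIntegrable (fun σ => 3 * (K * A σ * (t - σ) ^ (β / 2 - 1))) volume s t := by
      have h' := (hAi.const_mul K).const_mul 3
      refine h'.congr ?_
      exact fun σ _ => by ring
    exact this
  · rw [hΙ, ← hμ]
    refine (ae_restrict_iff' measurableSet_Ioo).2 (Eventually.of_forall fun σ hσ w _ => ?_)
    have hmem := fun j k => memLp_top_slice_of_bound hmeas (σ := σ) (hB σ hσ) j k
    refine HasFDerivAt.fun_sum fun i _ => ?_
    exact ((((contDiff_oseenHeat hE (fun j k => (hmem j k).1) (sub_pos.2 hσ.2) i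
      (n := 1)).differentiable one_ne_zero) w).hasFDerivAt).smul_const (e i)


/-- **Size of the derivative of the Duhamel integral on Hölder forcing**:
`‖∫ₛᵗ D(𝒩_{t−σ}G(σ))(x) dσ‖ ≤ ∫ₛᵗ 3·(2κ(1+2κ)2943 · A(σ)(t − σ)^{β/2−1}) dσ`. [folklore] -/
theorem norm_integral_sum_fderiv_oseenHeat_smulRight_le
    (hmeas : ∀ j k, Measurable fun q : ℝ × E => G q.1 j k q.2) {B : ℝ} (hB0 : 0 ≤ B) {s t : ℝ}
    (hst : s < t) (hB : ∀ σ ∈ Ioo s t, ∀ j k y, |G σ j k y| ≤ B) {A : ℝ → ℝ} {β : ℝ}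
    (hβ0 : 0 ≤ β) (hβ1 : β ≤ 1) (hA0 : ∀ σ ∈ Ioo s t, 0 ≤ A σ)
    (hH : ∀ σ ∈ Ioo s t, ∀ j k y z, |G σ j k y - G σ j k z| ≤ A σ * ‖y - z‖ ^ β)
    (hAi : IntervalIntegrable (fun σ => A σ * (t - σ) ^ (β / 2 - 1)) volume s t) (x : E) :
    ‖∫ σ in s..t, ∑ i, (fderiv ℝ (oseenHeat (t - σ) (G σ) i) x).smulRight
        (stdOrthonormalBasis ℝ E i)‖ ≤
      ∫ σ in s..t, 3 * ((2 * (2 : ℝ) ^ ((Module.finrank ℝ E : ℝ) / 2) *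
        (1 + 2 * (2 : ℝ) ^ ((Module.finrank ℝ E : ℝ) / 2)) * 2943) * A σ * (t - σ) ^ (β / 2 - 1)) := by
  refine intervalIntegral.norm_integral_le_of_norm_le hst.le (ae_mem_Ioc_of_forall_Ioo fun σ hσ =>
    norm_sum_fderiv_oseenHeat_smulRight_le hE hmeas hB0 hB hβ0 hβ1 hA0 hH hσ x) ?_
  have h' := (hAi.const_mul ((2 * (2 : ℝ) ^ ((Module.finrank ℝ E : ℝ) / 2) *
        (1 + 2 * (2 : ℝ) ^ ((Module.finrank ℝ E : ℝ) / 2)) * 2943))).const_mul 3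
  refine h'.congr ?_
  exact fun σ _ => by ring

end DuhamelGrad

/-! ### Level 1: the gradient of the slices of a restarted-mild field -/

section SliceGradient

variable {E : Type*} [NormedAddCommGroup E] [InnerProductSpace ℝ E] [FiniteDimensional ℝ E]
  [MeasurableSpace E] [BorelSpace E]

variable {T N : ℝ} {V : ℝ → E → E}
variable (hE : Module.finrank ℝ E = 3)
include hE

/-- **Level 1 — differentiability of the slices of a restarted-mild field**, with the derivative
of the mild formula: `D V(t) = D e^{(t−s)Δ}V(s) − ∫ₛᵗ D 𝒩_{t−σ}[V ⊗ V](σ) dσ` (`0 < s < t < T`;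
dominated differentiation on the `β`-Hölder forcing `V ⊗ V`, `0 < β < 1`, Level ½).
[cite: KochNadirashviliSereginSverak2009, §4 Prop. 4.1, towards (4.6) with k = 1, l = 0 (arXiv:0709.3599v1 p. 8)] -/
theorem IsKNSSDriftMild.hasFDerivAt_slice (h : IsKNSSDriftMild T N V 0) {β : ℝ} (hβ0 : 0 < β)
    (hβ1 : β < 1) {s t : ℝ} (hs : 0 < s) (hst : s < t) (ht : t < T) (x : E) :
    HasFDerivAt (V t)
      (fderiv ℝ (UnboundedOperators.heatExtension (V s) (t - s)) x -
        ∫ σ in s..t, ∑ i, (fderiv ℝ (oseenHeat (t - σ) (driftTensor V 0 σ) i) x).smulRight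
          (stdOrthonormalBasis ℝ E i)) x := by
  have hT : 0 < T := hs.trans (hst.trans ht)
  have hsT : s ∈ Ioo 0 T := ⟨hs, hst.trans ht⟩
  have hN : 0 ≤ N := h.nonneg
  set κ : ℝ := (2 : ℝ) ^ ((Module.finrank ℝ E : ℝ) / 2) with hκ
  set KH : ℝ := (2 : ℝ) ^ (1 - β) * κ ^ β * N with hKH
  set KD : ℝ := (2 : ℝ) ^ (1 - β) * (2 * κ) ^ β * (2943 * (4 * N ^ 2)) with hKD
  have hKH0 : 0 ≤ KH := by positivity
  have hKD0 : 0 ≤ KD := by positivity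
  -- the Hölder constants of the forcing `V ⊗ V`
  set A : ℝ → ℝ := fun σ => 2 * N * (KH * (σ - s) ^ (-(β / 2)) +
    3 * KD * ((σ - s) ^ ((1 - β) / 2) / ((1 - β) / 2))) with hA
  have hA0 : ∀ σ ∈ Ioo s t, 0 ≤ A σ := fun σ hσ => by
    have h1 : 0 ≤ (σ - s) ^ (-(β / 2)) := Real.rpow_nonneg (sub_pos.2 hσ.1).le _
    have h2 : 0 ≤ (σ - s) ^ ((1 - β) / 2) / ((1 - β) / 2) :=
      div_nonneg (Real.rpow_nonneg (sub_pos.2 hσ.1).le _) (by linarith)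
    simp only [hA]; positivity
  have hB : ∀ σ ∈ Ioo s t, ∀ j k w, |driftTensor V 0 σ j k w| ≤ 4 * N ^ 2 := fun σ hσ j k w =>
    h.abs_driftTensor_le ⟨hs.trans hσ.1, hσ.2.trans ht⟩ j k w
  have hH : ∀ σ ∈ Ioo s t, ∀ j k y z, |driftTensor V 0 σ j k y - driftTensor V 0 σ j k z| ≤
      A σ * ‖y - z‖ ^ β := by
    intro σ hσ j k y z
    have hσT : σ < T := hσ.2.trans ht
    have hhol := fun y z => h.norm_slice_sub_le_holder hE hβ0.le hβ1 hs hσ.1 hσT y z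
    have := abs_driftTensor_zero_sub_le (fun w => h.norm_le σ ⟨hs.trans hσ.1, hσT⟩ w) hhol j k y z
    refine this.trans (le_of_eq ?_)
    simp only [hA, hKH, hKD]
    ring
  -- integrability of the majorant
  have hAi : IntervalIntegrable (fun σ => A σ * (t - σ) ^ (β / 2 - 1)) volume s t := by
    have i1 := intervalIntegrable_rpow_neg_mul_rpow_neg (a := 1 - β / 2) (b := β / 2) (s := s)
      (t := t) (by linarith) (by linarith) hst
    have i2 := intervalIntegrable_rpow_neg_mul_rpow_neg (a := 1 - β / 2) (b := -((1 - β) / 2))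
      (s := s) (t := t) (by linarith) (by linarith) hst
    refine ((i1.const_mul (2 * N * KH)).add (i2.const_mul (2 * N * (3 * KD / ((1 - β) / 2))))).congr
      fun σ _ => ?_
    simp only [hA, neg_neg, show -(1 - β / 2) = β / 2 - 1 by ring]
    field_simp
  have hD := hasFDerivAt_integral_sum_oseenHeat_duhamel hE h.measurable_driftTensor (by positivity)
    hst hB hβ0.le hβ1.le hA0 hH hAi x
  have hVs : MemLp (V s) ∞ volume := h.memLp_top_slice hsT
  have hheat : HasFDerivAt (UnboundedOperators.heatExtension (V s) (t - s))
      (fderiv ℝ (UnboundedOperators.heatExtension (V s) (t - s)) x) x :=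
    (((UnboundedOperators.contDiff_heatExtension_holds hVs le_top (sub_pos.2 hst)).differentiable
      (by simp)) x).hasFDerivAt
  have hfun : V t = fun w => UnboundedOperators.heatExtension (V s) (t - s) w -
      ∫ σ in s..t, ∑ i, oseenHeat (t - σ) (driftTensor V 0 σ) i w • stdOrthonormalBasis ℝ E i := by
    funext w; rw [h.mild s t hs hst ht w, driftDuhamel_apply]
  rw [hfun]
  exact hheat.sub hD

/-- **Level 1 — the a priori gradient bound of a restarted-mild field** (`0 < β < 1` a free
interpolation parameter, `κ = 2^{n/2}`, `K = 2κ(1+2κ)2943`):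
`‖D V(t)(x)‖ ≤ κ N (t − s)^{-1/2} + 6K·(2^{1−β}κ^β N)(1/(1−β/2) + 1/(β/2))·N
  + 6K·(3·2^{1−β}(2κ)^β·2943·4N²/((1−β)/2))·(2/β)·N·(t − s)^{1/2}`,
i.e. `N (t − s)^{-1/2}·(κ + O(N (t − s)^{1/2}) + O(N²(t − s)))` — (4.6) with `k = 1`, `l = 0` in the
short window `N²(t − s) ≲ 1`. [cite: KochNadirashviliSereginSverak2009, §4 Prop. 4.1, (4.6) with k = 1, l = 0 (arXiv:0709.3599v1 p. 8)] -/
theorem IsKNSSDriftMild.norm_fderiv_slice_le (h : IsKNSSDriftMild T N V 0) {β : ℝ} (hβ0 : 0 < β)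
    (hβ1 : β < 1) {s t : ℝ} (hs : 0 < s) (hst : s < t) (ht : t < T) (x : E) :
    ‖fderiv ℝ (V t) x‖ ≤
      (2 : ℝ) ^ ((Module.finrank ℝ E : ℝ) / 2) * (t - s) ^ (-(1 / 2 : ℝ)) * N +
      6 * (2 * (2 : ℝ) ^ ((Module.finrank ℝ E : ℝ) / 2) *
          (1 + 2 * (2 : ℝ) ^ ((Module.finrank ℝ E : ℝ) / 2)) * 2943) *
        ((2 : ℝ) ^ (1 - β) * ((2 : ℝ) ^ ((Module.finrank ℝ E : ℝ) / 2)) ^ β * N) *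
        (1 / (1 - β / 2) + 1 / (β / 2)) * N +
      6 * (2 * (2 : ℝ) ^ ((Module.finrank ℝ E : ℝ) / 2) *
          (1 + 2 * (2 : ℝ) ^ ((Module.finrank ℝ E : ℝ) / 2)) * 2943) *
        (3 * ((2 : ℝ) ^ (1 - β) * (2 * (2 : ℝ) ^ ((Module.finrank ℝ E : ℝ) / 2)) ^ β *
          (2943 * (4 * N ^ 2))) / ((1 - β) / 2)) * (2 / β) * N * (t - s) ^ (1 / 2 : ℝ) := by
  have hT : 0 < T := hs.trans (hst.trans ht)
  have hsT : s ∈ Ioo 0 T := ⟨hs, hst.trans ht⟩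
  have hN : 0 ≤ N := h.nonneg
  have hd : 0 < t - s := sub_pos.2 hst
  set κ : ℝ := (2 : ℝ) ^ ((Module.finrank ℝ E : ℝ) / 2) with hκ
  set K : ℝ := 2 * κ * (1 + 2 * κ) * 2943 with hK
  set KH : ℝ := (2 : ℝ) ^ (1 - β) * κ ^ β * N with hKH
  set KD : ℝ := (2 : ℝ) ^ (1 - β) * (2 * κ) ^ β * (2943 * (4 * N ^ 2)) with hKD
  have hK0 : 0 ≤ K := by positivity
  have hKH0 : 0 ≤ KH := by positivity
  have hKD0 : 0 ≤ KD := by positivity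
  set A : ℝ → ℝ := fun σ => 2 * N * (KH * (σ - s) ^ (-(β / 2)) +
    3 * KD * ((σ - s) ^ ((1 - β) / 2) / ((1 - β) / 2))) with hA
  have hA0 : ∀ σ ∈ Ioo s t, 0 ≤ A σ := fun σ hσ => by
    have h1 : 0 ≤ (σ - s) ^ (-(β / 2)) := Real.rpow_nonneg (sub_pos.2 hσ.1).le _
    have h2 : 0 ≤ (σ - s) ^ ((1 - β) / 2) / ((1 - β) / 2) :=
      div_nonneg (Real.rpow_nonneg (sub_pos.2 hσ.1).le _) (by linarith)
    simp only [hA]; positivity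
  have hB : ∀ σ ∈ Ioo s t, ∀ j k w, |driftTensor V 0 σ j k w| ≤ 4 * N ^ 2 := fun σ hσ j k w =>
    h.abs_driftTensor_le ⟨hs.trans hσ.1, hσ.2.trans ht⟩ j k w
  have hH : ∀ σ ∈ Ioo s t, ∀ j k y z, |driftTensor V 0 σ j k y - driftTensor V 0 σ j k z| ≤
      A σ * ‖y - z‖ ^ β := by
    intro σ hσ j k y z
    have hσT : σ < T := hσ.2.trans ht
    have hhol := fun y z => h.norm_slice_sub_le_holder hE hβ0.le hβ1 hs hσ.1 hσT y z
    have := abs_driftTensor_zero_sub_le (fun w => h.norm_le σ ⟨hs.trans hσ.1, hσT⟩ w) hhol j k y z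
    refine this.trans (le_of_eq ?_)
    simp only [hA, hKH, hKD]
    ring
  have i1 := intervalIntegrable_rpow_neg_mul_rpow_neg (a := 1 - β / 2) (b := β / 2) (s := s)
    (t := t) (by linarith) (by linarith) hst
  have i2 := intervalIntegrable_rpow_neg_mul_rpow_neg (a := 1 - β / 2) (b := -((1 - β) / 2))
    (s := s) (t := t) (by linarith) (by linarith) hst
  have hAeq : ∀ σ, A σ * (t - σ) ^ (β / 2 - 1) =
      2 * N * KH * ((t - σ) ^ (-(1 - β / 2)) * (σ - s) ^ (-(β / 2))) +
        2 * N * (3 * KD / ((1 - β) / 2)) * ((t - σ) ^ (-(1 - β / 2)) * (σ - s) ^ (-(-((1 - β) / 2)))) := by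
    intro σ
    simp only [hA, neg_neg, show -(1 - β / 2) = β / 2 - 1 by ring]
    field_simp
  have hAi : IntervalIntegrable (fun σ => A σ * (t - σ) ^ (β / 2 - 1)) volume s t :=
    ((i1.const_mul (2 * N * KH)).add (i2.const_mul (2 * N * (3 * KD / ((1 - β) / 2))))).congr
      fun σ _ => (hAeq σ).symm
  -- the derivative formula and the two pieces
  have hder := (h.hasFDerivAt_slice hE hβ0 hβ1 hs hst ht x).fderiv
  rw [hder]
  have hVs : AEStronglyMeasurable (V s) volume :=
    (h.measurable.comp (measurable_const.prodMk measurable_id)).aestronglyMeasurable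
  have hheat := UnboundedOperators.norm_fderiv_heatExtension_le_of_bounded hVs
    (fun z => h.norm_le s hsT z) hd x
  have hduh := norm_integral_sum_fderiv_oseenHeat_smulRight_le hE h.measurable_driftTensor
    (by positivity) hst hB hβ0.le hβ1.le hA0 hH hAi x
  -- evaluate/bound the majorant integral
  have hW1 := integral_rpow_neg_mul_rpow_neg_le (a := 1 - β / 2) (b := β / 2) (s := s) (t := t)
    (by linarith) (by linarith) (by linarith) (by linarith) hst
  rw [show 1 - β / 2 + β / 2 - 1 = (0 : ℝ) by ring, show 1 - (1 - β / 2) - β / 2 = (0 : ℝ) by ring,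
    Real.rpow_zero, Real.rpow_zero, mul_one, show (1 : ℝ) - β / 2 = 1 - β / 2 by rfl] at hW1
  -- second weight: `(σ - s)^{(1-β)/2} ≤ (t - s)^{(1-β)/2}` and `∫ (t-σ)^{-(1-β/2)} = (t-s)^{β/2}/(β/2)`
  have hi3 : IntervalIntegrable (fun σ => (t - σ) ^ (-(1 - β / 2))) volume s t := by
    have := (intervalIntegral.intervalIntegrable_rpow' (a := t - s) (b := 0)
      (by linarith : (-1 : ℝ) < -(1 - β / 2))).comp_sub_left t
    simpa using this
  have hW2 : ∫ σ in s..t, (t - σ) ^ (-(1 - β / 2)) * (σ - s) ^ (-(-((1 - β) / 2))) ≤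
      (t - s) ^ ((1 - β) / 2) * ((t - s) ^ (β / 2) / (β / 2)) := by
    calc ∫ σ in s..t, (t - σ) ^ (-(1 - β / 2)) * (σ - s) ^ (-(-((1 - β) / 2)))
        ≤ ∫ σ in s..t, (t - σ) ^ (-(1 - β / 2)) * (t - s) ^ ((1 - β) / 2) := by
          refine intervalIntegral.integral_mono_on hst.le i2 (hi3.mul_const _) fun σ hσ => ?_
          rw [neg_neg]
          exact mul_le_mul_of_nonneg_left (Real.rpow_le_rpow (sub_nonneg.2 hσ.1) (by linarith [hσ.2])
            (by linarith)) (Real.rpow_nonneg (sub_nonneg.2 hσ.2) _)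
      _ = (t - s) ^ ((1 - β) / 2) * ((t - s) ^ (β / 2) / (β / 2)) := by
          rw [intervalIntegral.integral_mul_const, integral_rpow_sub_left_eq (by linarith),
            show -(1 - β / 2) + 1 = β / 2 by ring]
          ring
  have hhalf : (t - s) ^ ((1 - β) / 2) * ((t - s) ^ (β / 2) / (β / 2)) =
      (2 / β) * (t - s) ^ (1 / 2 : ℝ) := by
    rw [mul_div_assoc', ← Real.rpow_add hd, show (1 - β) / 2 + β / 2 = (1 / 2 : ℝ) by ring]
    field_simp
  rw [hhalf] at hW2
  have hmaj : ∫ σ in s..t, 3 * (K * A σ * (t - σ) ^ (β / 2 - 1)) ≤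
      6 * K * KH * (1 / (1 - β / 2) + 1 / (β / 2)) * N +
        6 * K * (3 * KD / ((1 - β) / 2)) * (2 / β) * N * (t - s) ^ (1 / 2 : ℝ) := by
    have hsplit : ∫ σ in s..t, 3 * (K * A σ * (t - σ) ^ (β / 2 - 1)) =
        6 * K * N * KH * (∫ σ in s..t, (t - σ) ^ (-(1 - β / 2)) * (σ - s) ^ (-(β / 2))) +
        6 * K * N * (3 * KD / ((1 - β) / 2)) *
          (∫ σ in s..t, (t - σ) ^ (-(1 - β / 2)) * (σ - s) ^ (-(-((1 - β) / 2)))) := by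
      rw [← intervalIntegral.integral_const_mul, ← intervalIntegral.integral_const_mul,
        ← intervalIntegral.integral_add (i1.const_mul _) (i2.const_mul _)]
      refine intervalIntegral.integral_congr fun σ _ => ?_
      show 3 * (K * A σ * (t - σ) ^ (β / 2 - 1)) = _
      rw [mul_assoc K, hAeq σ]
      ring
    rw [hsplit]
    have hc1 : 0 ≤ 6 * K * N * KH := by positivity
    have hc2 : 0 ≤ 6 * K * N * (3 * KD / ((1 - β) / 2)) := by
      have : 0 < (1 - β) / 2 := by linarith
      positivity
    calc _ ≤ 6 * K * N * KH * (1 / (1 - β / 2) + 1 / (1 - (1 - β / 2))) +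
          6 * K * N * (3 * KD / ((1 - β) / 2)) * ((2 / β) * (t - s) ^ (1 / 2 : ℝ)) :=
          add_le_add (mul_le_mul_of_nonneg_left hW1 hc1) (mul_le_mul_of_nonneg_left hW2 hc2)
      _ = _ := by
          rw [show 1 - (1 - β / 2) = β / 2 by ring]
          ring
  calc ‖fderiv ℝ (UnboundedOperators.heatExtension (V s) (t - s)) x -
        ∫ σ in s..t, ∑ i, (fderiv ℝ (oseenHeat (t - σ) (driftTensor V 0 σ) i) x).smulRight
          (stdOrthonormalBasis ℝ E i)‖
      ≤ κ * (t - s) ^ (-(1 / 2 : ℝ)) * N + ∫ σ in s..t, 3 * (K * A σ * (t - σ) ^ (β / 2 - 1)) :=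
        (norm_sub_le _ _).trans (add_le_add hheat hduh)
    _ ≤ κ * (t - s) ^ (-(1 / 2 : ℝ)) * N + (6 * K * KH * (1 / (1 - β / 2) + 1 / (β / 2)) * N +
        6 * K * (3 * KD / ((1 - β) / 2)) * (2 / β) * N * (t - s) ^ (1 / 2 : ℝ)) := by
        gcongr
    _ = _ := by ring

/-- **(4.6) with `k = 1`, `l = 0` for restarted-mild fields, windowed form**: there is a universal
`C` such that `(t − s)^{1/2}‖D V(t)(x)‖ ≤ C N` whenever `0 < s < t < T` and `N²(t − s) ≤ 1`
(`β = 1/2` in `norm_fderiv_slice_le`). [cite: KochNadirashviliSereginSverak2009, §4 Prop. 4.1, (4.6) (k = 1, l = 0) (arXiv:0709.3599v1 p. 8)] -/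
theorem IsKNSSDriftMild.exists_gradient_bound :
    ∃ C : ℝ, 0 ≤ C ∧ ∀ ⦃T N : ℝ⦄ ⦃V : ℝ → E → E⦄, IsKNSSDriftMild T N V 0 →
      ∀ ⦃s t : ℝ⦄, 0 < s → s < t → t < T → N ^ 2 * (t - s) ≤ 1 →
        ∀ x, (t - s) ^ (1 / 2 : ℝ) * ‖fderiv ℝ (V t) x‖ ≤ C * N := by
  set κ : ℝ := (2 : ℝ) ^ ((Module.finrank ℝ E : ℝ) / 2) with hκ
  set K : ℝ := 2 * κ * (1 + 2 * κ) * 2943 with hK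
  set β : ℝ := 1 / 2 with hβ
  have hβ0 : 0 < β := by norm_num [hβ]
  have hβ1 : β < 1 := by norm_num [hβ]
  set P : ℝ := 6 * K * ((2 : ℝ) ^ (1 - β) * κ ^ β) * (1 / (1 - β / 2) + 1 / (β / 2)) with hP
  set Q : ℝ := 6 * K * (3 * ((2 : ℝ) ^ (1 - β) * (2 * κ) ^ β * (2943 * 4)) / ((1 - β) / 2)) *
    (2 / β) with hQ
  have hK0 : 0 ≤ K := by positivity
  have hP0 : 0 ≤ P := by
    have : 0 < 1 - β / 2 := by norm_num [hβ]
    positivity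
  have hQ0 : 0 ≤ Q := by
    have : 0 < (1 - β) / 2 := by norm_num [hβ]
    positivity
  refine ⟨κ + P + Q, by positivity, fun T N V h s t hs hst ht hwin x => ?_⟩
  have hN : 0 ≤ N := h.nonneg
  have hd : 0 < t - s := sub_pos.2 hst
  have hb := h.norm_fderiv_slice_le hE hβ0 hβ1 hs hst ht x
  -- `N (t-s)^{1/2} ≤ 1`
  have hr : 0 ≤ (t - s) ^ (1 / 2 : ℝ) := Real.rpow_nonneg hd.le _
  have hsq : ((t - s) ^ (1 / 2 : ℝ)) ^ 2 = t - s := by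
    rw [← Real.rpow_natCast, ← Real.rpow_mul hd.le]; norm_num
  have hNr : N * (t - s) ^ (1 / 2 : ℝ) ≤ 1 := by
    have h2 : (N * (t - s) ^ (1 / 2 : ℝ)) ^ 2 ≤ 1 := by rw [mul_pow, hsq]; exact hwin
    nlinarith [mul_nonneg hN hr]
  have hNr2 : N ^ 2 * (t - s) ≤ 1 := hwin
  have hhalf : (t - s) ^ (1 / 2 : ℝ) * (t - s) ^ (-(1 / 2 : ℝ)) = 1 := by
    rw [← Real.rpow_add hd]; norm_num
  -- multiply the three-term bound by `(t - s)^{1/2}`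
  have key : (t - s) ^ (1 / 2 : ℝ) * (κ * (t - s) ^ (-(1 / 2 : ℝ)) * N +
      6 * K * ((2 : ℝ) ^ (1 - β) * κ ^ β * N) * (1 / (1 - β / 2) + 1 / (β / 2)) * N +
      6 * K * (3 * ((2 : ℝ) ^ (1 - β) * (2 * κ) ^ β * (2943 * (4 * N ^ 2))) / ((1 - β) / 2)) *
        (2 / β) * N * (t - s) ^ (1 / 2 : ℝ)) =
      κ * N + P * N * (N * (t - s) ^ (1 / 2 : ℝ)) + Q * N * (N * (t - s) ^ (1 / 2 : ℝ)) ^ 2 := by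
    have hrpos : 0 < (t - s) ^ (1 / 2 : ℝ) := Real.rpow_pos_of_pos hd _
    have hinv : (t - s) ^ (-(1 / 2 : ℝ)) = ((t - s) ^ (1 / 2 : ℝ))⁻¹ := Real.rpow_neg hd.le _
    rw [hinv, hP, hQ]
    have : (1 - β) / 2 ≠ 0 := by norm_num [hβ]
    have h2 : 1 - β / 2 ≠ 0 := by norm_num [hβ]
    field_simp
  calc (t - s) ^ (1 / 2 : ℝ) * ‖fderiv ℝ (V t) x‖
      ≤ (t - s) ^ (1 / 2 : ℝ) * _ := mul_le_mul_of_nonneg_left hb hr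
    _ = κ * N + P * N * (N * (t - s) ^ (1 / 2 : ℝ)) + Q * N * (N * (t - s) ^ (1 / 2 : ℝ)) ^ 2 := key
    _ ≤ κ * N + P * N * 1 + Q * N * 1 := by
        have h1 : (N * (t - s) ^ (1 / 2 : ℝ)) ^ 2 ≤ 1 := by rw [mul_pow, hsq]; exact hwin
        gcongr
    _ = (κ + P + Q) * N := by ring

end SliceGradient

end Literature.Analysis.FluidPDE

end
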